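import Literature.AlgebraicGeometry.HilbertScheme.HeisenbergMonomialBasis
import Mathlib.Data.Prod.Lex
import Mathlib.Data.List.Sort
import HarnessLib

/-!
# The Heisenberg monomials SPAN `ℍₙ` — the spanning half of the Nakajima–Grojnowski basis theorem, PROVED from the
# axioms of a Heisenberg representation (Lehn's argument for Cor. 2.6)

Layer `Literature/AlgebraicGeometry/HilbertScheme`; sequel of `HeisenbergMonomialBasis` (which states the NAMED FACT
`Nakajima1997_heisenbergMonomialBasis`: the monomials `Π_c 𝔞_{−ρ(c)}(x_c)|0⟩`, `ρ ∈ 𝒫ₙ`, are linearly independent AND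
span `ℍₙ = H*(S^[n])`).  This file PROVES the second conjunct for EVERY representation `(q, vac)` satisfying the tree's
axioms `IsHeisenbergRepresentation` over a field with `2 ≠ 0`, and every homogeneous spanning family `x` of the
coefficient space — pure algebra, no geometry, 0 new facts:

* `IsHeisenbergRepresentation.span_heisenbergMonomial_eq_range` — `span {Π_c 𝔞_{−ρ(c)}(x_c)|0⟩ : ρ ∈ 𝒫ₙ} = ℍₙ`;
* `NakajimaOperators.span_heisenbergMonomial_eq_range` — the same on the tree's carriers (`𝔑 : NakajimaOperators hS H`,
  `ℍₙ = H*(S^[n](ℂ); ℂ)`): literally the spanning conjunct of `Nakajima1997_heisenbergMonomialBasis`, now a theorem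
  (the fact's hypothesis `LinearIndependent ℂ x` is not needed for it).

THE PRINTED ARGUMENT (Lehn, Invent. Math. 136 (1999), proof of Cor. 2.6 with Thm. 2.5 = Nakajima's relations; LQW,
Math. Ann. 324 (2002) p. 5: "`ℍ` is an irreducible representation of the Heisenberg algebra generated by `H*(X)` with
the vacuum vector `|0⟩`… a linear basis of `ℍ` is given by `𝔮_{i₁}(α₁)⋯𝔮_{i_k}(α_k)|0⟩`, `i₁ ≥ ⋯ ≥ i_k > 0`, where the
`α`'s run over a linear basis of `H*(X)`"; LQW, J. reine angew. Math. 554 (2003) §6 p. 13: "the corresponding `𝔞_ρ(n)`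
linearly span `H*(X^[n])` as a corollary to the theorem of Nakajima and Grojnowski"), as formalised here:

1. (`mul_eq_sign_smul_mul`, `mul_self_eq_zero_of_odd`) Two CREATION letters super-commute: for `m + l ≠ 0` the
   Heisenberg relation has no central term, so `𝔮ₘ(a)𝔮ₗ(b) = (−1)^{|a||b|} 𝔮ₗ(b)𝔮ₘ(a)`, and `𝔮ₘ(a)² = 0` for `|a|` odd
   (`2𝔮ₘ(a)² = 0`).
2. (`mul_letterMonomial_eq_sign_smul`) Hence a creation letter moves past a creation word at the cost of a sign.
3. (`mul_letterMonomial_vac_mem_sortedSpan`) Inserting a letter into a SORTED admissible word (letters `(c, r)` ordered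
   by colour then part — the printed "order fixed once and for all" — odd letters not repeated) gives `±` a sorted
   admissible word, or `0` when an odd letter gets doubled.
4. (`sortedSpan_eq_top`) The span of the sorted admissible monomials applied to `|0⟩` contains `|0⟩` and is stable
   under all creation operators `𝔮ₘ(v)`, `m > 0` (by 3 and linearity in `v`, `x` spanning the coefficients), hence is
   all of `ℍ` by the CYCLICITY axiom ("`ℍ` is generated by the vacuum": Lehn Cor. 2.6 `S*W₊ ≅ ℍ`).
5. (`range_ofSummand_le_sortedSpan`) Projecting to the summand `ℍₙ` (the monomial of a word of total mode `n'` lies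
   in `ℍ_{n'}`, bi-degree axiom) keeps only the words of total mode `n`.
6. (`letterWord_canonList`, `canonList_countFn`, `isPartitionValued_countFn`) A sorted admissible word of total mode
   `n` IS the word `pvWord x n ρ` of the partition-valued function `ρ = ` its letter counts (a sorted list is determined
   by its counts), so its monomial is `heisenbergMonomial q vac x n ρ` with `ρ ∈ 𝒫ₙ`.

## References

* M. Lehn, *Chern classes of tautological sheaves on Hilbert schemes of points on surfaces*, Invent. Math. 136 (1999)
  157–207 [`Lehn1999`], Thm. 2.5, Cor. 2.6 and its proof (p. 8).
* W.-P. Li, Z. Qin, W. Wang, Math. Ann. 324 (2002) 105–133 [`LiQinWang2002`], §2 p. 5; J. reine angew. Math. 554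
  (2003) 217–234 [`LiQinWang2003`], §6 p. 13.
* H. Nakajima, Ann. of Math. 145 (1997) 379–388 [`Nakajima1997`], Thm. 1.2 / §8; I. Grojnowski, Math. Res. Lett. 3
  (1996) 275–291 [`Grojnowski1996`].

HONEST FRAMING: the linear-independence conjunct of `Nakajima1997_heisenbergMonomialBasis` is NOT proved here (it needs
the non-degeneracy of the pairing); nothing here asserts L1 / `LefschetzGenerationHilb n` / MODEL_X / HC_Kum4Type / HC.
-/

noncomputable section

open DirectSum

universe u v w

namespace Literature.AlgebraicGeometry.HilbertScheme

/-! ### 1. Creation letters super-commute -/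

section Letters

variable {K : Type u} [Field K]
variable {A : ℕ → Type v} [∀ i, AddCommGroup (A i)] [∀ i, Module K (A i)]
variable {Φ : ℕ → ℕ → Type w} [∀ n i, AddCommGroup (Φ n i)] [∀ n i, Module K (Φ n i)]
variable {B : (⨁ i, A i) →ₗ[K] (⨁ i, A i) →ₗ[K] K} {q : ℤ → (⨁ i, A i) →ₗ[K] Module.End K (Fock Φ)} {vac : Fock Φ}

namespace IsHeisenbergRepresentation

/-- **Letters of modes `m, l` with `m + l ≠ 0` super-commute**: `𝔮ₘ(a)𝔮ₗ(b) = (−1)^{|a||b|} 𝔮ₗ(b)𝔮ₘ(a)` (the central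
term `δ_{m+l,0} m⟨a,b⟩` of the Heisenberg relation vanishes). [cite: LiQinWang2002, Thm. 2.16 (i) and (2.7) p. 5]
[cite: Lehn1999, Thm. 2.5] -/
theorem mul_eq_sign_smul_mul (h : IsHeisenbergRepresentation B q vac) {m l : ℤ} (hml : m + l ≠ 0) (i j : ℕ)
    (a : A i) (b : A j) :
    q m (lof K ℕ A i a) * q l (lof K ℕ A j b) = ((-1 : K) ^ (i * j)) • (q l (lof K ℕ A j b) * q m (lof K ℕ A i a)) := by
  have hb := h.bracket m l i j a b
  rw [if_neg hml] at hb
  exact sub_eq_zero.1 hb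

/-- **An odd creation/annihilation letter squares to zero**: `𝔮ₘ(a)𝔮ₘ(a) = 0` for `|a|` odd and `m ≠ 0` (the relation
reads `2·𝔮ₘ(a)² = 0`; `2 ≠ 0` in `K`). [cite: LiQinWang2002, Thm. 2.16 (i) and (2.7) p. 5] [cite: LiQinWang2003, §6
p. 13 ("for every `c ∈ S₁`, the partition `ρ(c)` is required to be strict")] -/
theorem mul_self_eq_zero_of_odd (h : IsHeisenbergRepresentation B q vac) (h2 : (2 : K) ≠ 0) {m : ℤ} (hm : m ≠ 0)
    {i : ℕ} (hi : Odd i) (a : A i) :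
    q m (lof K ℕ A i a) * q m (lof K ℕ A i a) = 0 := by
  have hb := h.mul_eq_sign_smul_mul (m := m) (l := m) (by omega) i i a a
  rw [(hi.mul hi).neg_one_pow] at hb
  -- evaluate on vectors (the scalar action on `Module.End` is the pointwise one)
  refine LinearMap.ext fun y ↦ ?_
  have hy : (q m (lof K ℕ A i a) * q m (lof K ℕ A i a)) y =
      (-1 : K) • (q m (lof K ℕ A i a) * q m (lof K ℕ A i a)) y := by
    have := LinearMap.congr_fun hb y
    exact this
  rw [neg_one_smul, eq_neg_iff_add_eq_zero, ← two_smul K] at hy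
  rw [LinearMap.zero_apply]
  exact (smul_eq_zero.1 hy).resolve_left h2

end IsHeisenbergRepresentation

end Letters

/-! ### 2. Index letters `(c, r)` (colour, part), their words and monomials -/

section IndexWords

variable {V : Type v} {N : ℕ}

/-- The colour `c` of an index letter `(c, r)` (letters are ordered lexicographically: colour, then part — "we fix the
order of the elements `c ∈ S` … once and for all", parts increasing inside a colour). [cite: LiQinWang2003, §6 p. 13] -/
abbrev letterColour (σ : Lex (Fin N × ℕ)) : Fin N := (ofLex σ).1

/-- The part (creation mode) `r` of an index letter `(c, r)`. [cite: LiQinWang2003, §6 p. 13] -/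
abbrev letterPart (σ : Lex (Fin N × ℕ)) : ℕ := (ofLex σ).2

/-- The colour of the letter `(c, r)` is `c`. [cite: LiQinWang2003, §6 p. 13] -/
@[simp]
theorem letterColour_toLex (c : Fin N) (r : ℕ) : letterColour (toLex (c, r)) = c := rfl

/-- The part of the letter `(c, r)` is `r`. [cite: LiQinWang2003, §6 p. 13] -/
@[simp]
theorem letterPart_toLex (c : Fin N) (r : ℕ) : letterPart (toLex (c, r)) = r := rfl

/-- The word `[(r₁, x_{c₁}), …, (r_k, x_{c_k})]` of a list of index letters `[(c₁, r₁), …, (c_k, r_k)]`.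
[cite: LiQinWang2003, §6 p. 13] -/
def letterWord (x : Fin N → V) (L : List (Lex (Fin N × ℕ))) : List (ℕ × V) :=
  L.map fun σ ↦ (letterPart σ, x (letterColour σ))

/-- The word of no letters is empty. [cite: LiQinWang2003, §6 p. 13] -/
@[simp]
theorem letterWord_nil (x : Fin N → V) : letterWord x [] = [] := rfl

/-- The word of `σ :: L` starts with the letter `(r, x_c)` of `σ = (c, r)`. [cite: LiQinWang2003, §6 p. 13] -/
@[simp]
theorem letterWord_cons (x : Fin N → V) (σ : Lex (Fin N × ℕ)) (L : List (Lex (Fin N × ℕ))) :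
    letterWord x (σ :: L) = (letterPart σ, x (letterColour σ)) :: letterWord x L := rfl

/-- The word of a concatenation is the concatenation of the words. [cite: LiQinWang2003, §6 p. 13] -/
theorem letterWord_append (x : Fin N → V) (L L' : List (Lex (Fin N × ℕ))) :
    letterWord x (L ++ L') = letterWord x L ++ letterWord x L' := by
  simp [letterWord]

/-- The total degree-sum `Σ deg(cⱼ)` of the colours of a list of letters (governs the sign of moving a letter past it).
[cite: LiQinWang2002, (2.7) p. 5] -/
def letterDegSum (deg : Fin N → ℕ) (L : List (Lex (Fin N × ℕ))) : ℕ :=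
  (L.map fun σ ↦ deg (letterColour σ)).sum

/-- The degree-sum of no letters is `0`. [cite: LiQinWang2002, (2.7) p. 5] -/
@[simp]
theorem letterDegSum_nil (deg : Fin N → ℕ) : letterDegSum deg [] = 0 := by
  simp [letterDegSum]

/-- The degree-sum of `σ :: L`. [cite: LiQinWang2002, (2.7) p. 5] -/
@[simp]
theorem letterDegSum_cons (deg : Fin N → ℕ) (σ : Lex (Fin N × ℕ)) (L : List (Lex (Fin N × ℕ))) :
    letterDegSum deg (σ :: L) = deg (letterColour σ) + letterDegSum deg L := by
  simp [letterDegSum]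

/-- **Admissible sorted words**: letters in (weakly) increasing lexicographic order, all parts `≥ 1`, and a letter of
ODD colour never repeated ("for every `c ∈ S₁` … `m_r(c) = 0` or `1`"). [cite: LiQinWang2003, §6 p. 13] -/
def IsAdmissibleWord (deg : Fin N → ℕ) (L : List (Lex (Fin N × ℕ))) : Prop :=
  (∀ σ ∈ L, 1 ≤ letterPart σ) ∧
    L.Pairwise fun σ τ ↦ σ ≤ τ ∧ (Odd (deg (letterColour σ)) → σ ≠ τ)

/-- The empty word is admissible (its monomial applied to `|0⟩` is `|0⟩`). [cite: LiQinWang2003, §6 p. 13] -/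
theorem IsAdmissibleWord.nil (deg : Fin N → ℕ) : IsAdmissibleWord deg ([] : List (Lex (Fin N × ℕ))) :=
  ⟨fun _ h ↦ (List.not_mem_nil h).elim, List.Pairwise.nil⟩

/-- A sublist of an admissible word is admissible. [cite: LiQinWang2003, §6 p. 13] -/
theorem IsAdmissibleWord.sublist {deg : Fin N → ℕ} {L L' : List (Lex (Fin N × ℕ))} (h : IsAdmissibleWord deg L)
    (hL' : L'.Sublist L) : IsAdmissibleWord deg L' :=
  ⟨fun σ hσ ↦ h.1 σ (hL'.subset hσ), h.2.sublist hL'⟩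

/-- An admissible word is sorted. [cite: LiQinWang2003, §6 p. 13] -/
theorem IsAdmissibleWord.pairwise_le {deg : Fin N → ℕ} {L : List (Lex (Fin N × ℕ))} (h : IsAdmissibleWord deg L) :
    L.Pairwise (· ≤ ·) :=
  h.2.imp fun h ↦ h.1

end IndexWords

/-! ### 3. Moving a creation letter past a creation word; inserting it into a sorted admissible word -/

section Representation

variable {K : Type u} [Field K]
variable {A : ℕ → Type v} [∀ i, AddCommGroup (A i)] [∀ i, Module K (A i)]
variable {Φ : ℕ → ℕ → Type w} [∀ n i, AddCommGroup (Φ n i)] [∀ n i, Module K (Φ n i)]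
variable {B : (⨁ i, A i) →ₗ[K] (⨁ i, A i) →ₗ[K] K} {q : ℤ → (⨁ i, A i) →ₗ[K] Module.End K (Fock Φ)} {vac : Fock Φ}
variable {N : ℕ} {x : Fin N → ⨁ i, A i} {deg : Fin N → ℕ}

/-- In a sorted list, every element from the first one `≥ σ` on is `≥ σ` (list plumbing). [folklore] -/
private theorem le_of_mem_dropWhile {α : Type*} [LinearOrder α] {σ : α} {L : List α}
    (hL : L.Pairwise (· ≤ ·)) : ∀ τ ∈ L.dropWhile (fun τ ↦ decide (τ < σ)), σ ≤ τ := by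
  induction L with
  | nil => simp
  | cons a L ih =>
    intro τ hτ
    rw [List.dropWhile_cons] at hτ
    split_ifs at hτ with ha
    · exact ih (List.pairwise_cons.1 hL).2 τ hτ
    · simp only [decide_eq_true_eq, not_lt] at ha
      rcases List.mem_cons.1 hτ with rfl | hτ'
      · exact ha
      · exact ha.trans ((List.pairwise_cons.1 hL).1 τ hτ')

variable (q x) in
/-- **The span of the sorted admissible monomials** `𝔮_{r₁}(x_{c₁})⋯𝔮_{r_k}(x_{c_k})|0⟩`, `(c₁,r₁) ≤ ⋯ ≤ (c_k,r_k)`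
(odd letters not repeated) — it will be all of `ℍ`. [cite: LiQinWang2002, §2 p. 5 ("a linear basis of `ℍ` is given by
`𝔮_{i₁}(α₁)⋯𝔮_{i_k}(α_k)|0⟩`")] [cite: Lehn1999, Cor. 2.6] -/
def sortedSpan (vac : Fock Φ) (deg : Fin N → ℕ) : Submodule K (Fock Φ) :=
  Submodule.span K {w | ∃ L, IsAdmissibleWord deg L ∧ w = monomialOp q (letterWord x L) vac}

namespace IsHeisenbergRepresentation

/-- **A creation letter moves past a word of letters of non-negative modes at the cost of the sign
`(−1)^{|x_c| Σⱼ|x_{cⱼ}|}`.** [cite: LiQinWang2002, Thm. 2.16 (i) and (2.7) p. 5] [cite: Lehn1999, Thm. 2.5] -/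
theorem mul_letterMonomial_eq_sign_smul (h : IsHeisenbergRepresentation B q vac)
    (hx : ∀ c, x c ∈ LinearMap.range (lof K ℕ A (deg c))) {m : ℤ} (hm : 0 < m) (c : Fin N)
    (L : List (Lex (Fin N × ℕ))) :
    q m (x c) * monomialOp q (letterWord x L) =
      ((-1 : K) ^ (deg c * letterDegSum deg L)) • (monomialOp q (letterWord x L) * q m (x c)) := by
  induction L with
  | nil => rw [letterWord_nil, monomialOp_nil, letterDegSum_nil, mul_zero, pow_zero, one_smul, mul_one, one_mul]
  | cons τ L ih =>
    obtain ⟨a, ha⟩ := hx c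
    obtain ⟨b, hb⟩ := hx (letterColour τ)
    have key : q m (x c) * q (letterPart τ : ℤ) (x (letterColour τ)) =
        ((-1 : K) ^ (deg c * deg (letterColour τ))) • (q (letterPart τ : ℤ) (x (letterColour τ)) * q m (x c)) := by
      rw [← ha, ← hb]
      exact h.mul_eq_sign_smul_mul (by omega) _ _ a b
    rw [letterWord_cons, monomialOp_cons, letterDegSum_cons, ← mul_assoc, key, smul_mul_assoc, mul_assoc, ih,
      mul_smul_comm, smul_smul, ← pow_add, ← mul_assoc, mul_add]

/-- **Inserting a creation letter into a sorted admissible word**: `𝔮ₘ(x_c) · (Π_sorted 𝔮_{rⱼ}(x_{cⱼ})|0⟩)` is `±` a sorted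
admissible monomial applied to `|0⟩` (move `𝔮ₘ(x_c)` past the letters `< (c, m)`), or `0` when `x_c` is odd and the
letter `(c, m)` was already present (`𝔮ₘ(x_c)² = 0`); in either case it lies in the span of the sorted admissible
monomials. [cite: Lehn1999, proof of Cor. 2.6] [cite: LiQinWang2003, §6 p. 13] -/
theorem mul_letterMonomial_vac_mem_sortedSpan (h : IsHeisenbergRepresentation B q vac) (h2 : (2 : K) ≠ 0)
    (hx : ∀ c, x c ∈ LinearMap.range (lof K ℕ A (deg c))) {m : ℕ} (hm : 1 ≤ m) (c : Fin N)
    {L : List (Lex (Fin N × ℕ))} (hL : IsAdmissibleWord deg L) :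
    q (m : ℤ) (x c) (monomialOp q (letterWord x L) vac) ∈ sortedSpan q x vac deg := by
  set σ : Lex (Fin N × ℕ) := toLex (c, m) with hσ
  set P := L.takeWhile (fun τ ↦ decide (τ < σ)) with hP
  set S := L.dropWhile (fun τ ↦ decide (τ < σ)) with hS
  have hPS : P ++ S = L := List.takeWhile_append_dropWhile
  have hPlt : ∀ τ ∈ P, τ < σ := fun τ hτ ↦ by simpa using List.mem_takeWhile_imp hτ
  have hSge : ∀ τ ∈ S, σ ≤ τ := le_of_mem_dropWhile hL.pairwise_le
  have hPadm : IsAdmissibleWord deg P := hL.sublist (List.takeWhile_sublist _)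
  have hSadm : IsAdmissibleWord deg S := hL.sublist (List.dropWhile_sublist _)
  -- the product `𝔮ₘ(x_c) · M_L = ± M_{P ++ σ :: S}`
  have hprod : q (m : ℤ) (x c) * monomialOp q (letterWord x L) =
      ((-1 : K) ^ (deg c * letterDegSum deg P)) • monomialOp q (letterWord x (P ++ σ :: S)) := by
    rw [← hPS, letterWord_append, monomialOp_append, ← mul_assoc,
      h.mul_letterMonomial_eq_sign_smul hx (by exact_mod_cast hm) c P, smul_mul_assoc, mul_assoc,
      letterWord_append, letterWord_cons, monomialOp_append, monomialOp_cons]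
    rfl
  rw [← Module.End.mul_apply, hprod, LinearMap.smul_apply]
  refine Submodule.smul_mem _ _ ?_
  -- is the letter `σ` doubled with `x_c` odd?
  by_cases hbad : Odd (deg c) ∧ ∃ S', S = σ :: S'
  · -- then the new word contains `𝔮ₘ(x_c)𝔮ₘ(x_c) = 0`
    obtain ⟨hodd, S', hS'⟩ := hbad
    obtain ⟨a, ha⟩ := hx c
    have hzero : monomialOp q (letterWord x (P ++ σ :: S)) = 0 := by
      rw [hS', letterWord_append, letterWord_cons, letterWord_cons, monomialOp_append, monomialOp_cons,
        monomialOp_cons, ← mul_assoc (q _ _), show letterColour σ = c from rfl, show (letterPart σ : ℤ) = m from rfl,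
        ← ha, h.mul_self_eq_zero_of_odd h2 (by exact_mod_cast (show m ≠ 0 by omega)) hodd a, zero_mul, mul_zero]
    rw [hzero, LinearMap.zero_apply]
    exact Submodule.zero_mem _
  · -- otherwise `P ++ σ :: S` is again sorted admissible
    refine Submodule.subset_span ⟨P ++ σ :: S, ⟨?_, ?_⟩, rfl⟩
    · -- parts `≥ 1`
      intro τ hτ
      rcases List.mem_append.1 hτ with hτ | hτ
      · exact hPadm.1 τ hτ
      · rcases List.mem_cons.1 hτ with rfl | hτ
        · exact hm
        · exact hSadm.1 τ hτ
    · -- sorted, odd letters not repeated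
      have hσS : ∀ τ ∈ S, σ ≤ τ ∧ (Odd (deg (letterColour σ)) → σ ≠ τ) := by
        intro τ hτ
        refine ⟨hSge τ hτ, fun hodd hστ ↦ hbad ⟨hodd, ?_⟩⟩
        -- if `σ = τ ∈ S` then the head of `S` is squeezed: `σ ≤ head ≤ τ = σ`
        cases hS0 : S with
        | nil => rw [hS0] at hτ; exact (List.not_mem_nil hτ).elim
        | cons s₀ S' =>
          refine ⟨S', ?_⟩
          rw [hS0] at hτ hSge hSadm
          have hs₀ : σ ≤ s₀ := hSge s₀ List.mem_cons_self
          rcases List.mem_cons.1 hτ with rfl | hτ'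
          · rw [hστ]
          · have := (List.pairwise_cons.1 hSadm.2).1 τ hτ'
            rw [← hστ] at this
            rw [le_antisymm hs₀ this.1]
      rw [List.pairwise_append]
      refine ⟨hPadm.2, List.pairwise_cons.2 ⟨hσS, hSadm.2⟩, fun τ hτ τ' hτ' ↦ ?_⟩
      have hlt : τ < τ' := by
        rcases List.mem_cons.1 hτ' with rfl | hτ'
        · exact hPlt τ hτ
        · exact (hPlt τ hτ).trans_le (hSge τ' hτ')
      exact ⟨hlt.le, fun _ ↦ hlt.ne⟩

/-! ### 4. The sorted admissible monomials span `ℍ` (cyclicity) -/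

/-- **The sorted admissible monomials applied to `|0⟩` span `ℍ`**: their span contains `|0⟩` (empty word) and is stable
under every creation operator `𝔮ₘ(v)`, `m > 0` (insertion, and linearity in `v` with `x` spanning the coefficients),
so it is `ℍ` by cyclicity ("`ℍ` is … generated by … the vacuum vector"; Lehn: `S*W₊ ≅ ℍ`).
[cite: Lehn1999, Cor. 2.6] [cite: LiQinWang2002, §2 p. 5] -/
theorem sortedSpan_eq_top (h : IsHeisenbergRepresentation B q vac) (h2 : (2 : K) ≠ 0)
    (hx : ∀ c, x c ∈ LinearMap.range (lof K ℕ A (deg c))) (hsp : Submodule.span K (Set.range x) = ⊤) :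
    sortedSpan q x vac deg = ⊤ := by
  refine h.cyclic _ (Submodule.subset_span ⟨[], IsAdmissibleWord.nil deg, ?_⟩) ?_
  · rw [letterWord_nil, monomialOp_nil, Module.End.one_apply]
  · intro m hm v w hw
    have hv : v ∈ Submodule.span K (Set.range x) := by rw [hsp]; exact Submodule.mem_top
    induction hv using Submodule.span_induction with
    | mem v hv =>
      obtain ⟨c, rfl⟩ := hv
      induction hw using Submodule.span_induction with
      | mem w hw' =>
        obtain ⟨L, hL, rfl⟩ := hw'
        obtain ⟨m, rfl⟩ := Int.eq_ofNat_of_zero_le hm.le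
        exact h.mul_letterMonomial_vac_mem_sortedSpan h2 hx (by exact_mod_cast hm) c hL
      | zero => rw [map_zero]; exact Submodule.zero_mem _
      | add a b _ _ ha hb => rw [map_add]; exact Submodule.add_mem _ ha hb
      | smul r a _ ha => rw [map_smul]; exact Submodule.smul_mem _ r ha
    | zero => rw [map_zero, LinearMap.zero_apply]; exact Submodule.zero_mem _
    | add a b _ _ ha hb => rw [map_add, LinearMap.add_apply]; exact Submodule.add_mem _ ha hb
    | smul r a _ ha => rw [map_smul, LinearMap.smul_apply]; exact Submodule.smul_mem _ r ha

/-! ### 5. Projecting to the summand `ℍₙ` keeps the words of total mode `n` -/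

/-- **`ℍₙ` is spanned by the sorted admissible monomials of total mode `n`** (project `ℍ = ⨁ ℍₙ` onto `ℍₙ`: a
monomial of total mode `n'` lies in `ℍ_{n'}`, by the bi-degree axiom). [cite: LiQinWang2002, Def. 2.5 and Def. 2.9
pp. 4–5] [cite: LiQinWang2003, §6 p. 13] -/
theorem range_ofSummand_le_span_admissible (h : IsHeisenbergRepresentation B q vac) (h2 : (2 : K) ≠ 0)
    (hx : ∀ c, x c ∈ LinearMap.range (lof K ℕ A (deg c))) (hsp : Submodule.span K (Set.range x) = ⊤) (n : ℕ) :
    LinearMap.range (Fock.ofSummand K Φ n) ≤ Submodule.span K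
      {w | ∃ L, IsAdmissibleWord deg L ∧ wordMode (letterWord x L) = n ∧ w = monomialOp q (letterWord x L) vac} := by
  classical
  rintro _ ⟨z, rfl⟩
  let Pn : Module.End K (Fock Φ) :=
    Fock.ofSummand K Φ n ∘ₗ DirectSum.component K ℕ (fun p ↦ FockSummand Φ p) n
  have hfix : Pn (Fock.ofSummand K Φ n z) = Fock.ofSummand K Φ n z := by
    simp only [Pn, LinearMap.comp_apply, DirectSum.component.lof_self]
  have hmem : Fock.ofSummand K Φ n z ∈ sortedSpan q x vac deg := by
    rw [h.sortedSpan_eq_top h2 hx hsp]; exact Submodule.mem_top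
  rw [← hfix]
  have hmap : (sortedSpan q x vac deg).map Pn ≤ Submodule.span K {w | ∃ L, IsAdmissibleWord deg L ∧
      wordMode (letterWord x L) = n ∧ w = monomialOp q (letterWord x L) vac} := by
    rw [sortedSpan, Submodule.map_span, Submodule.span_le]
    rintro _ ⟨w, ⟨L, hL, rfl⟩, rfl⟩
    obtain ⟨z', hz'⟩ := h.monomialOp_vac_mem_range (letterWord x L)
    by_cases hn : wordMode (letterWord x L) = n
    · refine Submodule.subset_span ⟨L, hL, hn, ?_⟩
      rw [← hz']
      subst hn
      simp only [Pn, LinearMap.comp_apply, DirectSum.component.lof_self]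
    · have hkill : Pn (monomialOp q (letterWord x L) vac) = 0 := by
        rw [← hz']
        simp only [Pn, LinearMap.comp_apply]
        rw [DirectSum.component.of, dif_neg hn, map_zero]
      rw [SetLike.mem_coe, hkill]
      exact Submodule.zero_mem _
  exact hmap (Submodule.mem_map_of_mem hmem)

end IsHeisenbergRepresentation

end Representation

/-! ### 6. A sorted admissible word of total mode `n` is the word of the partition-valued function of its counts -/

section Counting

variable {V : Type v} {N : ℕ}

/-- The letter counts of a word, as a candidate partition-valued function of size `n`: `ρ c r = #{j : (cⱼ, rⱼ) = (c, r)}`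
(`m_r(c)` = the multiplicity of the part `r` in `ρ(c)`). [cite: LiQinWang2003, §6 p. 13] -/
def countFn (n : ℕ) (L : List (Lex (Fin N × ℕ))) : Fin N → Fin (n + 1) → ℕ :=
  fun c r ↦ L.count (toLex (c, (r : ℕ)))

/-- The canonical sorted word of a multiplicity function: colours ascending, parts ascending, `ρ c r` copies of `(c, r)`
(the index-letter form of `pvWord`). [cite: LiQinWang2003, §6 p. 13] -/
def canonList (n : ℕ) (ρ : Fin N → Fin (n + 1) → ℕ) : List (Lex (Fin N × ℕ)) :=
  (List.finRange N).flatMap fun c ↦ (List.finRange (n + 1)).flatMap fun r ↦ List.replicate (ρ c r) (toLex (c, (r : ℕ)))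

/-- The word of the canonical list of `ρ` is `pvWord x n ρ`. [cite: LiQinWang2003, §6 p. 13] -/
theorem letterWord_canonList (x : Fin N → V) (n : ℕ) (ρ : Fin N → Fin (n + 1) → ℕ) :
    letterWord x (canonList n ρ) = pvWord x n ρ := by
  simp [letterWord, canonList, pvWord, List.map_flatMap, List.map_replicate]

/-- The canonical list is sorted. [cite: LiQinWang2003, §6 p. 13] -/
theorem pairwise_le_canonList (n : ℕ) (ρ : Fin N → Fin (n + 1) → ℕ) : (canonList n ρ).Pairwise (· ≤ ·) := by
  rw [canonList, List.pairwise_flatMap]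
  constructor
  · intro c _
    rw [List.pairwise_flatMap]
    constructor
    · intro r _
      rw [List.pairwise_replicate]
      exact Or.inr le_rfl
    · refine (List.pairwise_lt_finRange (n + 1)).imp fun {r r'} hrr' τ hτ τ' hτ' ↦ ?_
      rw [List.eq_of_mem_replicate hτ, List.eq_of_mem_replicate hτ']
      exact le_of_lt (Prod.Lex.toLex_lt_toLex.2 (Or.inr ⟨rfl, by exact_mod_cast hrr'⟩))
  · refine (List.pairwise_lt_finRange N).imp fun {c c'} hcc' τ hτ τ' hτ' ↦ ?_
    obtain ⟨r, -, hτr⟩ := List.mem_flatMap.1 hτ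
    obtain ⟨r', -, hτr'⟩ := List.mem_flatMap.1 hτ'
    rw [List.eq_of_mem_replicate hτr, List.eq_of_mem_replicate hτr']
    exact le_of_lt (Prod.Lex.toLex_lt_toLex.2 (Or.inl hcc'))

/-- Letter counts of the canonical list. [cite: LiQinWang2003, §6 p. 13] -/
theorem count_canonList (n : ℕ) (ρ : Fin N → Fin (n + 1) → ℕ) (c' : Fin N) (r' : ℕ) :
    (canonList n ρ).count (toLex (c', r')) = if h : r' ≤ n then ρ c' ⟨r', Nat.lt_succ_of_le h⟩ else 0 := by
  classical
  have hsum : (canonList n ρ).count (toLex (c', r')) =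
      ∑ c : Fin N, ∑ r : Fin (n + 1), if c = c' ∧ (r : ℕ) = r' then ρ c r else 0 := by
    rw [canonList, List.count_flatMap, ← Fin.sum_univ_def]
    refine Finset.sum_congr rfl fun c _ ↦ ?_
    rw [Function.comp_apply, List.count_flatMap, ← Fin.sum_univ_def]
    refine Finset.sum_congr rfl fun r _ ↦ ?_
    rw [Function.comp_apply, List.count_replicate]
    congr 1
    simp [Prod.ext_iff]
  rw [hsum, Finset.sum_eq_single c']
  · split_ifs with hle
    · rw [Finset.sum_eq_single ⟨r', Nat.lt_succ_of_le hle⟩]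
      · simp
      · intro r _ hr
        rw [if_neg]
        exact fun hh ↦ hr (Fin.ext hh.2)
      · exact fun hh ↦ (hh (Finset.mem_univ _)).elim
    · refine Finset.sum_eq_zero fun r _ ↦ if_neg fun hh ↦ hle ?_
      rw [← hh.2]
      exact Nat.le_of_lt_succ r.2
  · intro c _ hc
    exact Finset.sum_eq_zero fun r _ ↦ if_neg fun hh ↦ hc hh.1
  · exact fun hh ↦ (hh (Finset.mem_univ _)).elim

/-- **A sorted word with parts `≤ n` is the canonical list of its counts** (a sorted list is determined by its letter
counts). [cite: LiQinWang2003, §6 p. 13] -/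
theorem canonList_countFn {n : ℕ} {L : List (Lex (Fin N × ℕ))} (hsorted : L.Pairwise (· ≤ ·))
    (hparts : ∀ σ ∈ L, letterPart σ ≤ n) : canonList n (countFn n L) = L := by
  classical
  refine List.Perm.eq_of_pairwise' (pairwise_le_canonList n _) hsorted (List.perm_iff_count.2 fun τ ↦ ?_)
  have hτ : toLex ((ofLex τ).1, (ofLex τ).2) = τ := rfl
  rw [← hτ, count_canonList]
  split_ifs with hle
  · rfl
  · exact (List.count_eq_zero.2 fun hmem ↦ hle (hparts _ hmem)).symm

/-- The total mode of the word of `L` is the sum of its parts. [cite: LiQinWang2003, §6 p. 13] -/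
theorem wordMode_letterWord (x : Fin N → V) (L : List (Lex (Fin N × ℕ))) :
    wordMode (letterWord x L) = (L.map letterPart).sum := by
  simp [wordMode, letterWord, List.map_map, Function.comp_def]

/-- Every part of a word is at most its total mode. [cite: LiQinWang2003, §6 p. 13] -/
theorem letterPart_le_wordMode (x : Fin N → V) {L : List (Lex (Fin N × ℕ))} {σ : Lex (Fin N × ℕ)} (hσ : σ ∈ L) :
    letterPart σ ≤ wordMode (letterWord x L) := by
  rw [wordMode_letterWord]
  exact List.le_sum_of_mem (List.mem_map.2 ⟨σ, hσ, rfl⟩)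

/-- **The counts of a sorted admissible word of total mode `n` form a partition-valued function of size `n`** (parts
`≥ 1`; odd colours strict because an odd letter is never repeated; `‖ρ‖ = n`). [cite: LiQinWang2003, §6 p. 13] -/
theorem isPartitionValued_countFn (x : Fin N → V) {deg : Fin N → ℕ} {n : ℕ} {L : List (Lex (Fin N × ℕ))}
    (hL : IsAdmissibleWord deg L) (hn : wordMode (letterWord x L) = n) : IsPartitionValued deg n (countFn n L) := by
  classical
  refine ⟨fun c ↦ ?_, fun c r hodd ↦ ?_, ?_⟩
  · exact List.count_eq_zero.2 fun hmem ↦ by simpa using hL.1 _ hmem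
  · by_contra hlt
    have hsub : (List.replicate 2 (toLex (c, (r : ℕ)) : Lex (Fin N × ℕ))).Sublist L :=
      List.replicate_sublist_iff.2 (by unfold countFn at hlt; omega)
    have := List.pairwise_replicate.1 (hL.2.sublist hsub)
    rcases this with h2 | ⟨-, hne⟩
    · omega
    · exact hne hodd rfl
  · have hparts : ∀ σ ∈ L, letterPart σ ≤ n := fun σ hσ ↦ hn ▸ letterPart_le_wordMode x hσ
    rw [← wordMode_pvWord x, ← letterWord_canonList, canonList_countFn hL.pairwise_le hparts, hn]

/-- **The monomial of a sorted admissible word of total mode `n` is the Heisenberg monomial of its counts.**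
[cite: LiQinWang2003, §6 p. 13] -/
theorem heisenbergMonomial_countFn {K : Type u} [Field K] [AddCommGroup V] [Module K V] {F : Type w} [AddCommGroup F]
    [Module K F] (q : ℤ → V →ₗ[K] Module.End K F) (vac : F) (x : Fin N → V) {deg : Fin N → ℕ} {n : ℕ}
    {L : List (Lex (Fin N × ℕ))} (hL : IsAdmissibleWord deg L) (hn : wordMode (letterWord x L) = n) :
    heisenbergMonomial q vac x n (countFn n L) = monomialOp q (letterWord x L) vac := by
  have hparts : ∀ σ ∈ L, letterPart σ ≤ n := fun σ hσ ↦ hn ▸ letterPart_le_wordMode x hσ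
  rw [heisenbergMonomial, ← letterWord_canonList, canonList_countFn hL.pairwise_le hparts]

end Counting

/-! ### 7. The spanning theorem -/

section Spanning

variable {K : Type u} [Field K]
variable {A : ℕ → Type v} [∀ i, AddCommGroup (A i)] [∀ i, Module K (A i)]
variable {Φ : ℕ → ℕ → Type w} [∀ n i, AddCommGroup (Φ n i)] [∀ n i, Module K (Φ n i)]
variable {B : (⨁ i, A i) →ₗ[K] (⨁ i, A i) →ₗ[K] K} {q : ℤ → (⨁ i, A i) →ₗ[K] Module.End K (Fock Φ)} {vac : Fock Φ}

/-- **The Heisenberg monomials `Π_c 𝔞_{−ρ(c)}(x_c)|0⟩`, `ρ ∈ 𝒫ₙ`, SPAN `ℍₙ`** — for every representation `(q, vac)`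
satisfying the axioms `IsHeisenbergRepresentation` over a field with `2 ≠ 0` and every homogeneous family `x` spanning
the coefficient space (Lehn's argument: cyclicity + the Heisenberg relations; steps 1–6 of the module docstring).
[cite: Lehn1999, Cor. 2.6] [cite: LiQinWang2003, §6 p. 13 ("linearly span `H*(X^[n])`")] [cite: LiQinWang2002, §2
p. 5] [cite: Nakajima1997, Thm. 1.2 / §8] -/
theorem IsHeisenbergRepresentation.span_heisenbergMonomial_eq_range (h : IsHeisenbergRepresentation B q vac)
    (h2 : (2 : K) ≠ 0) {N : ℕ} {x : Fin N → ⨁ i, A i} {deg : Fin N → ℕ}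
    (hx : ∀ c, x c ∈ LinearMap.range (lof K ℕ A (deg c))) (hsp : Submodule.span K (Set.range x) = ⊤) (n : ℕ) :
    Submodule.span K (Set.range fun ρ : {ρ : Fin N → Fin (n + 1) → ℕ // IsPartitionValued deg n ρ} ↦
        heisenbergMonomial q vac x n ρ.1) = LinearMap.range (Fock.ofSummand K Φ n) := by
  apply le_antisymm
  · rw [Submodule.span_le]
    rintro _ ⟨ρ, rfl⟩
    exact h.heisenbergMonomial_mem_range x ρ.2
  · refine (h.range_ofSummand_le_span_admissible h2 hx hsp n).trans (Submodule.span_le.2 ?_)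
    rintro _ ⟨L, hL, hn, rfl⟩
    exact Submodule.subset_span
      ⟨⟨countFn n L, isPartitionValued_countFn x hL hn⟩, heisenbergMonomial_countFn q vac x hL hn⟩

end Spanning

/-! ### 8. On the tree's carriers: the spanning conjunct of `Nakajima1997_heisenbergMonomialBasis` is a theorem -/

section Geometric

open Literature.AlgebraicGeometry.Motives (SchemeOver ComplexPoints IsSmoothProjective)
open Literature.AlgebraicGeometry.Hyperkaehler (totalCohomology ofDegree)

variable {S : SchemeOver ℂ} {hS : IsSmoothProjective 2 S} {H : HilbertSchemesOfPoints S}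

/-- **Nakajima–Grojnowski, spanning half, PROVED on the tree's interface**: for Nakajima operators `𝔑` of a choice `H`
of Hilbert schemes of a smooth projective surface `S`, every homogeneous family `x` spanning `H*(S(ℂ); ℂ)` and every
`n`, the monomials `Π_c 𝔞_{−ρ(c)}(x_c)|0⟩`, `ρ ∈ 𝒫ₙ`, span `ℍₙ = H*(S^[n](ℂ); ℂ)` — the second conjunct of the named fact
`Nakajima1997_heisenbergMonomialBasis` (whose hypothesis `LinearIndependent ℂ x` is not needed here).
[cite: LiQinWang2003, §6 p. 13] [cite: Nakajima1997, Thm. 1.2 / §8] [cite: Grojnowski1996, Thm. 1] [cite: Lehn1999,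
Cor. 2.6] -/
theorem NakajimaOperators.span_heisenbergMonomial_eq_range (𝔑 : NakajimaOperators hS H) {N : ℕ}
    {x : Fin N → totalCohomology ℂ (ComplexPoints S)} {deg : Fin N → ℕ}
    (hdeg : ∀ c, x c ∈ LinearMap.range (ofDegree ℂ (ComplexPoints S) (deg c)))
    (hsp : Submodule.span ℂ (Set.range x) = ⊤) (n : ℕ) :
    Submodule.span ℂ (Set.range fun ρ : {ρ : Fin N → Fin (n + 1) → ℕ // IsPartitionValued deg n ρ} ↦
        heisenbergMonomial 𝔑.q (vacuumVector H) x n ρ.1) =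
      LinearMap.range (Fock.ofSummand ℂ (fockFamily H) n) :=
  𝔑.isHeisenberg.span_heisenbergMonomial_eq_range two_ne_zero hdeg hsp n

end Geometric

end Literature.AlgebraicGeometry.HilbertScheme

end
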